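/-
Copyright (c) 2026 the pub-hodgecm2 formalisation cell (harness21).  New file, outside the frozen port manifest.
RE-CUT (2026-08-24, seat prover-pub-hodgecm2-mukey-p7-g3-0 = mukey-p7 g3, PLANNER-A R-34′ pen map; FILING HAND only): b10 g69's desk bytes
`HOME/pub-hodgecm2-b10/gen69/UniformOmegaMuSep.lean` (16 423 B) with (i) the `local notation 𝔏⟦…⟧` SPELLED OUT at its use sites (tonight's gate rule: no
notation of any kind) and (ii) every binder EXPLICIT per declaration (no section `variable`; D-0026) — the two theorem statements and proofs are
otherwise token-for-token b10's; authorship and the route are b10 g69's.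
Origin: seat `prover-pub-hodgecm2-b10-g69-0` (unit pub-hodgecm2-b10, gen 69; Δ2 BRIDGE cite-leg owner `hsepW ∕ hμsep`), 2026-08-23 —
VERSION-B, END binder `hμsep` («the cross-μ leg of [Liu21, App. D Lem D.1 (3)]», `PortJoin/ClosedPrinted.lean` §A, hand-written
`… → s.1.μ = t.1.μ` over `(𝕌 i).prop413Data (𝔇).H`) DISCHARGED at the model's μ-uniform carriers `Model.uniformOmegaRep … δ′ r` from two
LITERAL per-place as-printed families of [Liu2021, App. D Lem. D.1] — first sentence + (1), and (3) — read on the INDEXED FAMILY of the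
tree's own local data at `U(J_V)(F_v)` of all adèlic oscillator triples of `𝕌` (✔ Literature `Liu2021/Def411WeilCarriersLocalDataAtV`,
`Liu2021/LemD1AsPrintedIndexed`), plus weak approximation (✔ `GelbartRogawski1991/CMSplittingCharLocalMuSeparates`).  KERNEL only: theorems
(no notation, no `def`, no instance, no `variable`, no named fact, no `sorry`);
count-neutral; no pointer moves; nothing landed is edited.  HC_CM is NOT proved; «Δ2 BRIDGE CLOSED» is NOT claimed.
-/
import Summits.HodgeConjecture.CorCM.B01.Transposition.Item6UniformOmegaRepCiteLegs
import Literature.NumberTheory.Automorphic.Liu2021.Def411WeilCarriersLocalDataAtV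
import Literature.NumberTheory.GelbartRogawski1991.CMSplittingCharLocalMuSeparates
import HarnessLib

set_option autoImplicit false

/-!
# `hμsep` at `Model.uniformOmegaRep … δ′ r` from [Liu2021, App. D Lem. D.1 (1), (3)] AS PRINTED per place

With `U := Model.uniformOmegaRep h F ι₁ V Φ e dV hdV hdV0 ιV δ′ r` (✔ `Transposition/Item6UniformOmegaRep.lean`) and any consumer tower `H`,
the triples `t = (μ, ε, χ)` of [Liu2021, Prop. 4.13]'s datum `U.prop413Data H` carry the CONSTRUCTED carriers
`ω_t = omegaAtLine … (hsChiD … (toHeckeCharacter F μ) …) ((r μ hμ) ε) χ` with the `𝔾(𝔸_F^∞)`-action `rhoAtLine … ιV …`.  At a finite place `v`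
of `F⁺` the tree's local data of ALL these triples — indexed by `(⟨μ, hμ⟩, ε, χ)`, conjugate-symplectic `μ`, `ε ∈ Eps`, `χ ∈ Chi` (Def. 4.11: every
triple, no weight ∕ admissibility condition) — form ONE indexed family over the standing data `U(J_V)(F⁺_v)` of [Liu2021, App. D §D.1]
(`localIndexedFamilyAtV`: member `t` = Step 2 `μ_v = localMu F (toHeckeCharacter F μ) v`, Step 1 `(a_t·δ_F) ⊗ 1` with `a_t = (r μ hμ) ε`,
Step 3 `χ_v ∘ θ`, carrier `(chiLocalSplittingsD … μ … a_t).omegaLoc v ∘ (k ↦ k ⊗ 1)`):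

* the family `𝔏(v) := localIndexedFamilyAtV (ι := {μ // conjugate symplectic} × Eps × Chi) … v` — the Literature constructor at the model's terms,
  WRITTEN OUT IN FULL at each use (no notation); a consumer's displayed cite reads `∀ v, (𝔏(v)).Item1AsPrinted ∧ LemD1_3AsPrintedI (𝔏(v))`;
* **`Model.mu_eq_of_areIsomorphic_uniformOmegaRep_of_lemD1AsPrinted`** — EXACTLY the END's `hμsep` type at `U.prop413Data H`: for admissible
  triples `s, t` with `ω_s ≠ 0` and a `𝔾(𝔸_F^∞)`-equivariant `ℂ`-linear equivalence `ω_s ≃ ω_t`, `s.1.μ = t.1.μ` — from `ιV` onto (at the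
  pin: `ιVE V`, ✔ `finPart_cmKTypeHom_finAdelicToAdelic_surjective`), [Lem. D.1, first sentence + (1)] AS PRINTED at every member
  (`hD1V`) and [Lem. D.1 (3)] AS PRINTED on the family (`hD3`) at every finite place; route = ✔ `forall_localMu_eq_of_equiv_of_lemD1AsPrintedAtV`
  (restriction to `U(J_V)(F⁺_v)` [Flath], local separation [Lem. D.1 (3)]) + ✔ `eq_of_forall_localMu_toHeckeCharacter_eq` (weak approximation);
* `Model.admTriple_eq_of_areIsomorphic_uniformOmegaRep_of_thm418AsPrinted_of_lemD1AsPrinted` — the pay-off's full `hsep` (`s = t`) from the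
  displayed `hLiu` family at δ′ ([Thm. 4.18 (2)] AS PRINTED, own-htheta ✔ `…CiteLegs`) with its `hμsep` input now supplied by the above.

## References
* [Liu2021] Y. Liu, *Fourier–Jacobi cycles and arithmetic relative trace formula*, Camb. J. Math. 9 (2021) 1–147 = arXiv:2102.11518 —
  Def. 4.11 (FJcycle.tex ll. 2083–2097), Prop. 4.13 (ll. 2113–2119), Thm. 4.18 (2) and its proof (l. 2241, 2270), App. D §D.1 (l. 5213–5224),
  Lem. D.1 (l. 5226–5237; (1) l. 5229; (3) l. 5233).
* [FlathCorvallis1979] D. Flath, PSPM 33.1 (1979), Theorem 3.  [CasselsFrohlichANT1967] Ch. VII §8.  [GelbartRogawski1991] §3.1 Prop. 3.1.1.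
* Tree: `Transposition/Item6UniformOmegaRep.lean`, `Transposition/Item6UniformOmegaRepCiteLegs.lean`, `Transposition/Item6OmegaChiSplitting.lean`
  (`hsChiD`, `chiLocalSplittingsD`, `hfac_sChiD`), `Liu2021/Def411WeilCarriersLocalDataAtV.lean`, `Liu2021/LemD1AsPrintedIndexed.lean`,
  `GelbartRogawski1991/CMSplittingCharLocalMuSeparates.lean`.

HC_CM is NOT proved.
-/

noncomputable section

namespace Summit.HodgeConjecture.CorCM.Model

open NumberField IsDedekindDomain
open Literature.AlgebraicGeometry.Motives
open Literature.AlgebraicGeometry.ShimuraVarieties.UnitaryCanonicalModel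
open Literature.NumberTheory.Automorphic
open Literature.NumberTheory.Automorphic.IdeleClassGroup
open Literature.NumberTheory.Automorphic.Liu2021
open Literature.NumberTheory.Automorphic.Liu2021.AppendixC
open Literature.NumberTheory.Automorphic.Liu2021.AppendixC.RestOne
open Literature.NumberTheory.Automorphic.Liu2021.Def411WeilCarriers (Rep localIndexedFamilyAtV)
open Literature.NumberTheory.GelbartRogawski1991 Literature.NumberTheory.GelbartRogawski1991.UnitaryDualPair
open Literature.NumberTheory.GelbartRogawski1991.UnitaryDualPair.LocalSplitting (localMu norm_localMu continuous_localMu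
  localMu_toLocalRing_eq_one_iff eq_of_forall_localMu_toHeckeCharacter_eq)
open Literature.RepresentationTheory
open Literature.RepresentationTheory.Liu2021
open Summit.HodgeConjecture.CorCM.Transposition

-- (one application of the Literature theorem at the model's terms, the index type GIVEN EXPLICITLY (`ι := {μ // …} × Eps × Chi`), the family written out; the carrier fields of
-- `uniformOmegaRep` unfold by `rfl` when `hs ∕ hst` are fed to it — default heartbeats)
/-- **THE END's `hμsep` AT `Model.uniformOmegaRep … δ′ r`, from [Liu2021, App. D Lem. D.1 (1), (3)] AS PRINTED per place** («Statement (2)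
follows from Lemma D.1», l. 2270): for `ιV : 𝔾(𝔸_F^∞) → U(diag dV)(𝔸_{F⁺,f})` ONTO, [Lem. D.1, first sentence + (1)] AS PRINTED at every member of the
indexed family of local data of `U`'s triples (`hD1V`) and [Lem. D.1 (3)] AS PRINTED on that family (`hD3`), at every finite place `v` of `F⁺`:
two admissible triples `s, t` of [Prop. 4.13]'s datum `U.prop413Data H` whose summands `ω_s ≠ 0`, `ω_t` are related by a `𝔾(𝔸_F^∞)`-equivariant
`ℂ`-linear equivalence have THE SAME `μ` — EXACTLY the binder `hμsep` of ✔ `admTriple_eq_of_areIsomorphic_uniformOmegaRep_of_thm418AsPrinted` ∕ of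
the END `PortJoin/ClosedPrinted.lean` §A.  Route: restriction to `U(J_V)(F⁺_v)` (✔ `forall_localMu_eq_of_equiv_of_lemD1AsPrintedAtV`: Flath's
uniqueness, then Lem. D.1 (3) on the family) gives `localMu (μ_s) v = localMu (μ_t) v` for all `v`, and weak approximation
(✔ `eq_of_forall_localMu_toHeckeCharacter_eq`) gives `μ_s = μ_t`.  Nothing of [Liu2021] is asserted.
[cite: Liu2021, Def. 4.11 (ll. 2083–2097), Prop. 4.13 (ll. 2113–2119), Thm. 4.18 (2) with proof l. 2270, App. D Lemma D.1 (1), (3) (l. 5229, 5233)]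
[cite: FlathCorvallis1979, Theorem 3 (uniqueness clause)] [cite: CasselsFrohlichANT1967, Ch. VII §8 (proof of 8.7)] -/
theorem mu_eq_of_areIsomorphic_uniformOmegaRep_of_lemD1AsPrinted
    (h : exists_recordSystem) (F : CMField) [IsGalois ℚ F]
    (ι₁ : F →+* ℂ) (V : HermSpace3 F ι₁) (Φ : CMType F) {n : ℕ} (e : Fin 3 × Fin 1 ≃ Fin n) (dV : Fin 3 → F)
    (hdV : ∀ i, IsCMField.complexConj F (dV i) = dV i) (hdV0 : ∀ i, dV i ≠ 0)
    (ιV : (sec42DataOf h isoOf F ι₁ V Φ).G →*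
      UnitaryGroup.finAdelic ↥(maximalRealSubfield F) F (IsCMField.complexConj F) 3 (Matrix.diagonal dV))
    (δ' : F) (r : ∀ μ : Literature.NumberTheory.Automorphic.IdeleClassGroup F →ₜ* Circle,
      IdeleClassGroup.IsConjugateSymplectic F μ → Rep ↥(maximalRealSubfield F) (imagUnitSq F))
    (hn : 3 ≤ n)
    (H : Type) [AddCommGroup H] [Module ℂ H] [Module (MonoidAlgebra ℂ (sec42DataOf h isoOf F ι₁ V Φ).G) H]
    [IsScalarTower ℂ (MonoidAlgebra ℂ (sec42DataOf h isoOf F ι₁ V Φ).G) H]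
    (hιV : Function.Surjective ιV)
    (hD1V : ∀ v : HeightOneSpectrum (𝓞 ↥(maximalRealSubfield F)),
      (localIndexedFamilyAtV
          (ι := {μ : Literature.NumberTheory.Automorphic.IdeleClassGroup (F : Type) →ₜ* Circle // IdeleClassGroup.IsConjugateSymplectic (F : Type) μ} ×
            Def411WeilCarriers.Eps ↥(maximalRealSubfield (F : Type)) (imagUnitSq (F : Type)) ×
              Def411WeilCarriers.Chi ↥(maximalRealSubfield (F : Type)) (F : Type) (IsCMField.complexConj (F : Type)))
          ↥(maximalRealSubfield (F : Type)) (F : Type) (IsCMField.complexConj (F : Type)) 3 e (Matrix.diagonal dV)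
          (complexConj_imagUnit (F : Type)) (imagUnit_ne_zero (F : Type)) (imagUnit_mul_self (F : Type)) (realDiagonal_isSymm (F : Type) dV hdV)
          (isUnit_det_realDiagonal (F : Type) dV hdV hdV0) (realDiagonal_map (F : Type) dV hdV).symm hn
          (fun t => (r t.1.1 t.1.2).toFun t.2.1) (fun t => t.2.2)
          (fun t => OmegaChiSplitting.chiLocalSplittingsD F e dV hdV hdV0 (toHeckeCharacter (F : Type) t.1.1)
            ((isOscillatorChar_toHeckeCharacter_iff t.1.1).mpr t.1.2) ((r t.1.1 t.1.2).toFun t.2.1))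
          (fun t => localMu (F : Type) (toHeckeCharacter (F : Type) t.1.1))
          (fun t v x => norm_localMu (F : Type) (toHeckeCharacter (F : Type) t.1.1) v (isUnitary_toHeckeCharacter (F : Type) t.1.1) x)
          (fun t => continuous_localMu (F : Type) (toHeckeCharacter (F : Type) t.1.1))
          (fun t v x => localMu_toLocalRing_eq_one_iff (F : Type) (toHeckeCharacter (F : Type) t.1.1) v
            ((isOscillatorChar_toHeckeCharacter_iff t.1.1).mpr t.1.2) x) v).Item1AsPrinted)
    (hD3 : ∀ v : HeightOneSpectrum (𝓞 ↥(maximalRealSubfield F)), LemD1_3AsPrintedI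
      (localIndexedFamilyAtV
          (ι := {μ : Literature.NumberTheory.Automorphic.IdeleClassGroup (F : Type) →ₜ* Circle // IdeleClassGroup.IsConjugateSymplectic (F : Type) μ} ×
            Def411WeilCarriers.Eps ↥(maximalRealSubfield (F : Type)) (imagUnitSq (F : Type)) ×
              Def411WeilCarriers.Chi ↥(maximalRealSubfield (F : Type)) (F : Type) (IsCMField.complexConj (F : Type)))
          ↥(maximalRealSubfield (F : Type)) (F : Type) (IsCMField.complexConj (F : Type)) 3 e (Matrix.diagonal dV)
          (complexConj_imagUnit (F : Type)) (imagUnit_ne_zero (F : Type)) (imagUnit_mul_self (F : Type)) (realDiagonal_isSymm (F : Type) dV hdV)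
          (isUnit_det_realDiagonal (F : Type) dV hdV hdV0) (realDiagonal_map (F : Type) dV hdV).symm hn
          (fun t => (r t.1.1 t.1.2).toFun t.2.1) (fun t => t.2.2)
          (fun t => OmegaChiSplitting.chiLocalSplittingsD F e dV hdV hdV0 (toHeckeCharacter (F : Type) t.1.1)
            ((isOscillatorChar_toHeckeCharacter_iff t.1.1).mpr t.1.2) ((r t.1.1 t.1.2).toFun t.2.1))
          (fun t => localMu (F : Type) (toHeckeCharacter (F : Type) t.1.1))
          (fun t v x => norm_localMu (F : Type) (toHeckeCharacter (F : Type) t.1.1) v (isUnitary_toHeckeCharacter (F : Type) t.1.1) x)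
          (fun t => continuous_localMu (F : Type) (toHeckeCharacter (F : Type) t.1.1))
          (fun t v x => localMu_toLocalRing_eq_one_iff (F : Type) (toHeckeCharacter (F : Type) t.1.1) v
            ((isOscillatorChar_toHeckeCharacter_iff t.1.1).mpr t.1.2) x) v))
    (s t : ((uniformOmegaRep h F ι₁ V Φ e dV hdV hdV0 ιV δ' r).prop413Data H).AdmTriple)
    (hs : Nontrivial (((uniformOmegaRep h F ι₁ V Φ e dV hdV hdV0 ιV δ' r).prop413Data H).omegaAt s))
    (hst : ∃ f : ((uniformOmegaRep h F ι₁ V Φ e dV hdV hdV0 ιV δ' r).prop413Data H).omegaAt s ≃ₗ[ℂ]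
        ((uniformOmegaRep h F ι₁ V Φ e dV hdV hdV0 ιV δ' r).prop413Data H).omegaAt t,
      ∀ (g : (sec42DataOf h isoOf F ι₁ V Φ).G) (v : ((uniformOmegaRep h F ι₁ V Φ e dV hdV hdV0 ιV δ' r).prop413Data H).omegaAt s),
        f ((((uniformOmegaRep h F ι₁ V Φ e dV hdV hdV0 ιV δ' r).prop413Data H).rhoAt s) g v) =
          (((uniformOmegaRep h F ι₁ V Φ e dV hdV hdV0 ιV δ' r).prop413Data H).rhoAt t) g (f v)) :
    s.1.μ = t.1.μ := by
  -- the Literature theorem at the model's terms, at the two members `(μ_s, ε_s, χ_s)`, `(μ_t, ε_t, χ_t)` of the indexed family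
  have key := Def411WeilCarriers.forall_localMu_eq_of_equiv_of_lemD1AsPrintedAtV (ι := ({μ : Literature.NumberTheory.Automorphic.IdeleClassGroup F →ₜ* Circle // IdeleClassGroup.IsConjugateSymplectic F μ} ×
      Def411WeilCarriers.Eps ↥(maximalRealSubfield F) (imagUnitSq F) × Def411WeilCarriers.Chi ↥(maximalRealSubfield F) F (IsCMField.complexConj F))) ↥(maximalRealSubfield F) F
    (IsCMField.complexConj F) 3 e (Matrix.diagonal dV) (complexConj_imagUnit F) (imagUnit_ne_zero F) (imagUnit_mul_self F)
    (realDiagonal_isSymm F dV hdV) (isUnit_det_realDiagonal F dV hdV hdV0) (realDiagonal_map F dV hdV).symm hn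
    (fun t => (r t.1.1 t.1.2).toFun t.2.1) (fun t => t.2.2)
    (fun t => OmegaChiSplitting.chiLocalSplittingsD F e dV hdV hdV0 (toHeckeCharacter F t.1.1)
      ((isOscillatorChar_toHeckeCharacter_iff t.1.1).mpr t.1.2) ((r t.1.1 t.1.2).toFun t.2.1))
    (fun t => localMu F (toHeckeCharacter F t.1.1))
    (fun t v x => norm_localMu F (toHeckeCharacter F t.1.1) v (isUnitary_toHeckeCharacter F t.1.1) x)
    (fun t => continuous_localMu F (toHeckeCharacter F t.1.1))
    (fun t v x => localMu_toLocalRing_eq_one_iff F (toHeckeCharacter F t.1.1) v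
      ((isOscillatorChar_toHeckeCharacter_iff t.1.1).mpr t.1.2) x)
    (fun t a => OmegaChiSplitting.hsChiD F e dV hdV hdV0 (toHeckeCharacter F t.1.1) (isUnitary_toHeckeCharacter F t.1.1)
      ((isOscillatorChar_toHeckeCharacter_iff t.1.1).mpr t.1.2) a)
    (fun t => OmegaChiSplitting.hfac_sChiD F e dV hdV hdV0 (toHeckeCharacter F t.1.1) (isUnitary_toHeckeCharacter F t.1.1)
      ((isOscillatorChar_toHeckeCharacter_iff t.1.1).mpr t.1.2) ((r t.1.1 t.1.2).toFun t.2.1))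
    hD3 hιV hD1V ⟨⟨s.1.μ, s.1.isConjugateSymplectic⟩, s.1.ε, s.1.χ⟩ ⟨⟨t.1.μ, t.1.isConjugateSymplectic⟩, t.1.ε, t.1.χ⟩
  -- the triples' summands ARE those carriers (the carrier fields of `uniformOmegaRep` unfold), then weak approximation
  exact eq_of_forall_localMu_toHeckeCharacter_eq F s.1.μ t.1.μ (key hs hst)

/-- **The pay-off's full `hsep` (`s = t`) at `Model.uniformOmegaRep … δ′ r` from the displayed [Thm. 4.18 (2)] family at δ′ AND [Lem. D.1 (1), (3)]
AS PRINTED per place** — own-htheta's ✔ `admTriple_eq_of_areIsomorphic_uniformOmegaRep_of_thm418AsPrinted` with its `hμsep` input supplied by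
`mu_eq_of_areIsomorphic_uniformOmegaRep_of_lemD1AsPrinted`: no hand-written cross-`μ` binder remains.
[cite: Liu2021, Thm. 4.18 (2) (l. 2241) with proof l. 2270; App. D Lemma D.1 (1), (3) (l. 5229, 5233)] -/
theorem admTriple_eq_of_areIsomorphic_uniformOmegaRep_of_thm418AsPrinted_of_lemD1AsPrinted
    (h : exists_recordSystem) (F : CMField) [IsGalois ℚ F]
    (ι₁ : F →+* ℂ) (V : HermSpace3 F ι₁) (Φ : CMType F) {n : ℕ} (e : Fin 3 × Fin 1 ≃ Fin n) (dV : Fin 3 → F)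
    (hdV : ∀ i, IsCMField.complexConj F (dV i) = dV i) (hdV0 : ∀ i, dV i ≠ 0)
    (ιV : (sec42DataOf h isoOf F ι₁ V Φ).G →*
      UnitaryGroup.finAdelic ↥(maximalRealSubfield F) F (IsCMField.complexConj F) 3 (Matrix.diagonal dV))
    (δ' : F) (r : ∀ μ : Literature.NumberTheory.Automorphic.IdeleClassGroup F →ₜ* Circle,
      IdeleClassGroup.IsConjugateSymplectic F μ → Rep ↥(maximalRealSubfield F) (imagUnitSq F))
    (hn : 3 ≤ n)
    (H : Type) [AddCommGroup H] [Module ℂ H] [Module (MonoidAlgebra ℂ (sec42DataOf h isoOf F ι₁ V Φ).G) H]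
    [IsScalarTower ℂ (MonoidAlgebra ℂ (sec42DataOf h isoOf F ι₁ V Φ).G) H]
    (h6 : 6 ≤ Module.finrank ℚ F)
    (hιV : Function.Surjective ιV)
    (hLiuR : ∀ (μ : Literature.NumberTheory.Automorphic.IdeleClassGroup F →ₜ* Circle) (hμ : IdeleClassGroup.IsConjugateSymplectic F μ)
      (hw : IdeleClassGroup.HasWeight F μ 1),
      Thm418AsPrinted (toThm418Data (sec42DataOf h isoOf F ι₁ V Φ) (restOfCharRep h F h6 ι₁ V Φ e dV hdV hdV0 ιV δ' (r μ hμ) μ hμ hw)))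
    (hD1V : ∀ v : HeightOneSpectrum (𝓞 ↥(maximalRealSubfield F)),
      (localIndexedFamilyAtV
          (ι := {μ : Literature.NumberTheory.Automorphic.IdeleClassGroup (F : Type) →ₜ* Circle // IdeleClassGroup.IsConjugateSymplectic (F : Type) μ} ×
            Def411WeilCarriers.Eps ↥(maximalRealSubfield (F : Type)) (imagUnitSq (F : Type)) ×
              Def411WeilCarriers.Chi ↥(maximalRealSubfield (F : Type)) (F : Type) (IsCMField.complexConj (F : Type)))
          ↥(maximalRealSubfield (F : Type)) (F : Type) (IsCMField.complexConj (F : Type)) 3 e (Matrix.diagonal dV)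
          (complexConj_imagUnit (F : Type)) (imagUnit_ne_zero (F : Type)) (imagUnit_mul_self (F : Type)) (realDiagonal_isSymm (F : Type) dV hdV)
          (isUnit_det_realDiagonal (F : Type) dV hdV hdV0) (realDiagonal_map (F : Type) dV hdV).symm hn
          (fun t => (r t.1.1 t.1.2).toFun t.2.1) (fun t => t.2.2)
          (fun t => OmegaChiSplitting.chiLocalSplittingsD F e dV hdV hdV0 (toHeckeCharacter (F : Type) t.1.1)
            ((isOscillatorChar_toHeckeCharacter_iff t.1.1).mpr t.1.2) ((r t.1.1 t.1.2).toFun t.2.1))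
          (fun t => localMu (F : Type) (toHeckeCharacter (F : Type) t.1.1))
          (fun t v x => norm_localMu (F : Type) (toHeckeCharacter (F : Type) t.1.1) v (isUnitary_toHeckeCharacter (F : Type) t.1.1) x)
          (fun t => continuous_localMu (F : Type) (toHeckeCharacter (F : Type) t.1.1))
          (fun t v x => localMu_toLocalRing_eq_one_iff (F : Type) (toHeckeCharacter (F : Type) t.1.1) v
            ((isOscillatorChar_toHeckeCharacter_iff t.1.1).mpr t.1.2) x) v).Item1AsPrinted)
    (hD3 : ∀ v : HeightOneSpectrum (𝓞 ↥(maximalRealSubfield F)), LemD1_3AsPrintedI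
      (localIndexedFamilyAtV
          (ι := {μ : Literature.NumberTheory.Automorphic.IdeleClassGroup (F : Type) →ₜ* Circle // IdeleClassGroup.IsConjugateSymplectic (F : Type) μ} ×
            Def411WeilCarriers.Eps ↥(maximalRealSubfield (F : Type)) (imagUnitSq (F : Type)) ×
              Def411WeilCarriers.Chi ↥(maximalRealSubfield (F : Type)) (F : Type) (IsCMField.complexConj (F : Type)))
          ↥(maximalRealSubfield (F : Type)) (F : Type) (IsCMField.complexConj (F : Type)) 3 e (Matrix.diagonal dV)
          (complexConj_imagUnit (F : Type)) (imagUnit_ne_zero (F : Type)) (imagUnit_mul_self (F : Type)) (realDiagonal_isSymm (F : Type) dV hdV)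
          (isUnit_det_realDiagonal (F : Type) dV hdV hdV0) (realDiagonal_map (F : Type) dV hdV).symm hn
          (fun t => (r t.1.1 t.1.2).toFun t.2.1) (fun t => t.2.2)
          (fun t => OmegaChiSplitting.chiLocalSplittingsD F e dV hdV hdV0 (toHeckeCharacter (F : Type) t.1.1)
            ((isOscillatorChar_toHeckeCharacter_iff t.1.1).mpr t.1.2) ((r t.1.1 t.1.2).toFun t.2.1))
          (fun t => localMu (F : Type) (toHeckeCharacter (F : Type) t.1.1))
          (fun t v x => norm_localMu (F : Type) (toHeckeCharacter (F : Type) t.1.1) v (isUnitary_toHeckeCharacter (F : Type) t.1.1) x)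
          (fun t => continuous_localMu (F : Type) (toHeckeCharacter (F : Type) t.1.1))
          (fun t v x => localMu_toLocalRing_eq_one_iff (F : Type) (toHeckeCharacter (F : Type) t.1.1) v
            ((isOscillatorChar_toHeckeCharacter_iff t.1.1).mpr t.1.2) x) v))
    (s t : ((uniformOmegaRep h F ι₁ V Φ e dV hdV hdV0 ιV δ' r).prop413Data H).AdmTriple)
    (hs : Nontrivial (((uniformOmegaRep h F ι₁ V Φ e dV hdV hdV0 ιV δ' r).prop413Data H).omegaAt s))
    (hst : ∃ f : ((uniformOmegaRep h F ι₁ V Φ e dV hdV hdV0 ιV δ' r).prop413Data H).omegaAt s ≃ₗ[ℂ]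
        ((uniformOmegaRep h F ι₁ V Φ e dV hdV hdV0 ιV δ' r).prop413Data H).omegaAt t,
      ∀ (g : (sec42DataOf h isoOf F ι₁ V Φ).G) (v : ((uniformOmegaRep h F ι₁ V Φ e dV hdV hdV0 ιV δ' r).prop413Data H).omegaAt s),
        f ((((uniformOmegaRep h F ι₁ V Φ e dV hdV hdV0 ιV δ' r).prop413Data H).rhoAt s) g v) =
          (((uniformOmegaRep h F ι₁ V Φ e dV hdV hdV0 ιV δ' r).prop413Data H).rhoAt t) g (f v)) :
    s = t :=
  admTriple_eq_of_areIsomorphic_uniformOmegaRep_of_thm418AsPrinted h F h6 ι₁ V Φ e dV hdV hdV0 ιV δ' r H hLiuR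
    (fun s' t' hs' hst' => mu_eq_of_areIsomorphic_uniformOmegaRep_of_lemD1AsPrinted h F ι₁ V Φ e dV hdV hdV0 ιV δ' r hn H hιV hD1V hD3
      s' t' hs' hst')
    s t hs hst

end Summit.HodgeConjecture.CorCM.Model

end
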